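import Summits.QuantumFields.YangMills.Theorems.BalabanUVNodesN15TwoSpacingGluingNeumannKnitEntryThreeDefect
import HarnessLib

/-!
# THE GLUING STEP AT TWO LATTICE SPACINGS, XLVI: ENTRY 3 OF THE COVER's PARAMETRIX ON THE DOUBLED TORUS, TWO GRIDS (continued) — THE WEIGHTED-ROW DEFECT AND
# `𝔇((Σ∇′*∇′)G₀′, (Σ∇*∇)G₀) ≤ D(L^k)^{−1∕16}e^{−δd}` (dag-n15-c g13, FILE 88; N15 = NE2, s1 «background-layer OPERATOR ingredient»)

Cell `pub-ymgap`, seat `pub-ymgap-dag-n15-c` (R134 (a); HUMAN RULING D-0062), generation 13.  `bears_on: R4∕N15 · K3⁷ SpineGivenEndpointR13SepCoPH (stmt-QuantumFields-20544)`.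
Filed `--supports stmt-QuantumFields-20544 --as helper` — COUNT-NEUTRAL.  Theorems only (0 `def`, 0 `sorry`).  Imports BY NAME FILE 87 (through it FILES 83–86, 80, 66–79, 47 and dag-n15-a's
PROGRAMME N); nothing in the tree is modified.  (FILE 87 holds §1: the compressions and ★★★ `hasMaj_idef_commOp_lapOp_comp_knitG`.)

WHAT.  Doubled torus `M = MP (paramsOf d L (m+1) k hL)`, FILE 70's cover, `D₃ = Σ_μ∇*_μ∇_μ = Δ_a − N_L` at the coarse spacing `L^{−k}` and the fine spacing `L^{−(k+r)}`, King's pairing `P`: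
* §2 ★★★ `hasMaj_idef_mulOp_coverH_lap_knitG` — the two-grid defect of the WEIGHTED entry-3 row `𝔇(M_{h′}(Σ∇′*∇′)G′(□), M_h(Σ∇*∇)G(□)) ≤ 1_□1_□m₃(L^k)^{−1∕16}e^{−δd}`;
* §3 ★★★ **`hasMaj_idef_lap_parametrix_knit`** — `∃ δ D > 0 ∀ m k r (k ≥ 1, 4 ≤ L^k): 𝔇(D₃′∘G₀′, D₃∘G₀) ≤ D(L^k)^{−1∕16}e^{−δ|y−y′|_T}`: FILE 83 `hasMaj_idef_comp_parametrix_of_commOp_h` with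
  FILE 86's weighted rows, the weighted-row defect `𝔇(M_{h′} − M_{h′}χ′N_L′G′(□), M_h − M_hχN_LG(□))` (partition fit FILE 67 + FILE 80 `knitG_nonlocalDefect_row` = dag-n15-a N-IIm, through
  FILE 47 `hasMaj_localize_idef_sandwich` and FILE 46 `hasMaj_idef_mulOp_comp_loc`), FILE 72's fine commutator rows and FILE 87 §1.
FILES 86–88 are the entry-3 rows of FILE 50's `GluedLetters` for the glued `U ≡ 1` family (the `D₃′∘G₀′` majorant and the `𝔇(D₃′G₀′, D₃G₀)` defect).

HONEST FRAMING ∕ LIMITS.  Block-majorant bookkeeping over LANDED rows at `U ≡ 1` on the doubled-cube torus MODEL (Neumann-by-images cubes); no new analytic estimate.  Nothing of [B5]∕[B6]∕[B9]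
asserted ([B6] (2.133)–(2.136) p.247 shapes; [B9] Thm 3.14 pp.426–427 the difference template).  NE2⁺ NOT PRINTED, NOT proved; N15 NOT discharged; counts of record UNMOVED (typed 28∕28 ·
discharged 5∕27); one finite 𝕋⁴ at fixed ε per index — NOT infinite volume, NOT OS on ℝ⁴, NOT a mass gap, NOT Clay; R4 closes `BalabanLadder.UV` only.  Restate-immune (no Theses import).
-/

noncomputable section

namespace Summit.QuantumFields.YangMills.BalabanUVNodes.N15.Gluing

open Real
open Literature.MathematicalPhysics.QuantumFieldTheory.Balaban1983to89
open Literature.MathematicalPhysics.QuantumFieldTheory.Balaban1983to89.B5Prop11Plancherel (Tor fine)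
open Literature.MathematicalPhysics.QuantumFieldTheory.Balaban1983to89.B11SectG (BlockNorm HasMaj RowSum)
open Literature.MathematicalPhysics.QuantumFieldTheory.Balaban1983to89.T4EtaRateDefect (idef idef_sub)
open Literature.MathematicalPhysics.QuantumFieldTheory.Balaban1983to89.T4EtaRateCoeffDefect (pull diagK hasMaj_mulOp hasMaj_idef_mulOp diagK_le_decay)
open Literature.MathematicalPhysics.QuantumFieldTheory.Balaban1983to89.B6Prop26Gluing (mulOp mulOp_apply ind ind_nonneg ind_le_one)
open Literature.MathematicalPhysics.QuantumFieldTheory.Balaban1983to89.B6UnitTorusCarrier (unitTorusGeo triangle254_unitTorusGeo rowSum_unitTorusGeo unitTorusGeo_dist_nonneg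
  unitTorusGeo_dist_self)
open Literature.MathematicalPhysics.QuantumFieldTheory.Balaban1983to89.B5SiteBridgeP12 (MP)
open Literature.MathematicalPhysics.QuantumFieldTheory.King1986.Torus (blockOf tdistT tdistT_nonneg)
open Summit.QuantumFields.YangMills.BalabanUVNodes.N15.VectorPiece (bshiftEquiv kingPrV blkFine)
open Summit.QuantumFields.YangMills.BalabanUVNodes.N15.BackgroundLayer (fgrad fgradAdj bgrad symbOp_sD_eq)
open Summit.QuantumFields.YangMills.BalabanUVNodes.N15.TwoGrid (paramsOf deltaOp gOp neumannCubeG chiCube cubeBlocks landauRe qvRe qvAdjRe ineq110_114_pair hasMaj_gOp_of_ineq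
  hasMaj_landauRe hasMaj_chiCube_symOp_comp hasMaj_comp_mulOp_chiInt hasMaj_chiCube_grad_neumannCubeG hasMaj_chiCube_grad_neumannCubeG_fine hasMaj_chiCube_divAdjOut_neumannCubeG_pair
  hasMaj_chiCube_comp_neumannCubeG hasMaj_idef_chiCube_neumannCubeG hasMaj_idef_chiCube_grad_neumannCubeG hasMaj_idef_chiCube_divAdjOut_neumannCubeG)

variable {d : ℕ}

/-! ## §2 The two-grid defect of the weighted entry-3 row -/

section WeightedDefect

variable {L : ℕ} [NeZero L]
set_option maxHeartbeats 400000 in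
/-- ★★★ **THE TWO-GRID η-DEFECT OF THE WEIGHTED ENTRY-3 ROW OF EACH CUBE OF THE COVER ON THE DOUBLED TORUS**: for odd `L ≥ 3`, `a > 0` there are `δ, m₃ > 0` with
`𝔇(M_{h′_k}(Σ∇′*∇′)G′(□_k), M_{h_k}(Σ∇*∇)G(□_k)) ≤ 1_□(y)1_□(y′)·m₃(L^k)^{−1∕16}·e^{−δ|y−y′|_T}` for `k ≥ 1`, `4 ≤ L^k` — FILE 86's identity at both spacings, the partition fit (FILE 67) through
FILE 47 `hasMaj_localize_idef_sandwich`, and FILE 46 `hasMaj_idef_mulOp_comp_loc` on N-IIi's coarse row and the closed images-type row FILE 80 `knitG_nonlocalDefect_row` (dag-n15-a N-IIm).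
[cite: Balaban1984PropagatorsII, (2.37)–(2.38) p.229, (2.133)–(2.136) p.247 (shapes); Balaban1985BackgroundPropagators, Thm 3.14 pp.426–427 (difference template)] -/
theorem hasMaj_idef_mulOp_coverH_lap_knitG (hL : Odd L ∧ 1 < L) {a : ℝ} (ha : 0 < a) :
    ∃ δ m₃ : ℝ, 0 < δ ∧ 0 < m₃ ∧ ∀ (m kk r : ℕ) (_hk : 1 ≤ kk) (_hn4 : 4 ≤ L ^ kk) (k : Fin (d + 1) → ZMod (2 * L)),
      HasMaj (BlockNorm.ofBlocks (unitTorusGeo L kk (MP (paramsOf d L (m + 1) kk hL)))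
          (fun b : Tor (fine (L ^ kk) (MP (paramsOf d L (m + 1) kk hL))) × Fin (d + 1) => blockOf (L ^ kk) (MP (paramsOf d L (m + 1) kk hL)) b.1))
        (BlockNorm.ofBlocks (unitTorusGeo L kk (MP (paramsOf d L (m + 1) kk hL)))
          (fun i : Tor (fine (L ^ r * L ^ kk) (MP (paramsOf d L (m + 1) kk hL))) × Fin (d + 1) => blockOf (L ^ r * L ^ kk) (MP (paramsOf d L (m + 1) kk hL)) i.1))
        (idef (pull (kingPrV L kk r (MP (paramsOf d L (m + 1) kk hL)))) (pull (kingPrV L kk r (MP (paramsOf d L (m + 1) kk hL))))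
          (mulOp (knitH d L m kk (L ^ r * L ^ kk) hL k) ∘ₗ (lapOp ((L ^ r * L ^ kk : ℕ) : ℝ) (bshiftEquiv (MP (paramsOf d L (m + 1) kk hL)) (L ^ r * L ^ kk)) 0 ∘ₗ
            knitG d L m kk (L ^ r * L ^ kk) hL a k))
          (mulOp (knitH d L m kk (L ^ kk) hL k) ∘ₗ (lapOp ((L ^ kk : ℕ) : ℝ) (bshiftEquiv (MP (paramsOf d L (m + 1) kk hL)) (L ^ kk)) 0 ∘ₗ knitG d L m kk (L ^ kk) hL a k)))
        (fun y y' => ind ((cubeBlocks (MP (paramsOf d L (m + 1) kk hL)) (coverCorner (MP (paramsOf d L (m + 1) kk hL)) (L ^ m) L (coverMargin L m) k) (L * L ^ m) : Finset _) : Set _) y *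
          ind ((cubeBlocks (MP (paramsOf d L (m + 1) kk hL)) (coverCorner (MP (paramsOf d L (m + 1) kk hL)) (L ^ m) L (coverMargin L m) k) (L * L ^ m) : Finset _) : Set _) y' *
          (m₃ * ((L ^ kk : ℕ) : ℝ) ^ (-(1 / 16 : ℝ)) * Real.exp (-(δ * tdistT (MP (paramsOf d L (m + 1) kk hL)) y y')))) := by
  have hL3 : 3 ≤ L := by obtain ⟨⟨j, hj⟩, h1⟩ := hL; omega
  have hLpos : 0 < L := by omega
  obtain ⟨δ₀, C, Cα, Cε, Cαε, hδ₀, hC, H⟩ := ineq110_114_pair (d := d) hL ha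
  obtain ⟨δ₁, C₁, hδ₁, hC₁, HL⟩ := hasMaj_landauRe (d := d) (L := L)
  obtain ⟨δY, mY, hδY, hmY, HY⟩ := knitG_nonlocalDefect_row (d := d) hL ha
  set δm : ℝ := min δ₀ δ₁ with hδm_def
  have hδm : 0 < δm := lt_min hδ₀ hδ₁
  set δ : ℝ := min (δm / 2) δY with hδ_def
  have hδ : 0 < δ := lt_min (by positivity) hδY
  have hdm : δ ≤ δm / 2 := min_le_left _ _
  have hdY : δ ≤ δY := min_le_right _ _
  set cr : ℝ := B4Sect5Proof.latticeConst (d + 1) (δm / 4) with hcr_def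
  have hcr : 0 ≤ cr := B4Sect5Proof.latticeConst_nonneg (d + 1) (by positivity)
  set cN : ℝ := |a| * (Real.exp δm * Real.exp δm) + C₁ with hcN_def
  have hcN : 0 ≤ cN := by positivity
  set βY : ℝ := 2 ^ (d + 1) * (cN * (C * Real.exp δ₀) * cr) with hβY_def
  have hβY : 0 ≤ βY := by positivity
  set Ko : ℝ := π * (d + 1) with hKo_def
  refine ⟨δ, Ko + (mY + Ko * βY) + 1, hδ, by positivity, fun m kk r hk hn4 k => ?_⟩
  set M : Fin (d + 1) → ℕ := MP (paramsOf d L (m + 1) kk hL) with hMdef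
  have hM : ∀ ν, M ν = 2 * L * L ^ m := MP_succ_eq L m kk hL
  have hM' : ∀ ν, M ν = 2 * (L * L ^ m) := fun ν => by rw [hM ν, mul_assoc]
  have hw : 0 < L ^ m := pow_pos hLpos m
  have hn : 1 ≤ L ^ kk := Nat.one_le_pow _ _ hLpos
  have hfit := coverMargin_fit hL3 m
  have hfit1 : coverMargin L m + 2 * L ^ m + 1 ≤ L * L ^ m := by omega
  have hS : L * L ^ m ≤ 2 * L * L ^ m := by rw [mul_assoc]; omega
  have hwR : (1 : ℝ) ≤ ((L ^ m : ℕ) : ℝ) := by exact_mod_cast hw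
  have hnR : (1 : ℝ) ≤ ((L ^ kk : ℕ) : ℝ) := by exact_mod_cast hn
  set ε : ℝ := ((L ^ kk : ℕ) : ℝ) ^ (-(1 / 16 : ℝ)) with hε_def
  obtain ⟨-, hnwε, -, hε0⟩ := rpow_sixteenth_facts hnR hwR
  have hrow := rowSum_unitTorusGeo (L := L) (k := kk) (M := M) (σ := δm / 4) (by positivity)
  have hblk : (fun i : Tor (fine (L ^ r * L ^ kk) M) × Fin (d + 1) => blockOf (L ^ r * L ^ kk) M i.1) =
      (fun b : Tor (fine (L ^ kk) M) × Fin (d + 1) => blockOf (L ^ kk) M b.1) ∘ kingPrV L kk r M := (VectorPiece.blkFine_comp_kingPrV (M := M) L kk r).symm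
  set c : Tor M := coverCorner M (L ^ m) L (coverMargin L m) k with hc_def
  have hind : ∀ y y' : Tor M, 0 ≤ ind (g := unitTorusGeo L kk M) ((cubeBlocks M c (L * L ^ m) : Finset (Tor M)) : Set (Tor M)) y *
      ind (g := unitTorusGeo L kk M) ((cubeBlocks M c (L * L ^ m) : Finset (Tor M)) : Set (Tor M)) y' := fun y y' => mul_nonneg (ind_nonneg _ _) (ind_nonneg _ _)
  have E := congrArg₂ (idef (pull (kingPrV L kk r M)) (pull (kingPrV L kk r M)))
    (mulOp_coverH_comp_lapOp_comp_knitG (n := L ^ r * L ^ kk) (m₀ := coverMargin L m) hM hM' hw hfit1 hS ha k)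
    (mulOp_coverH_comp_lapOp_comp_knitG (n := L ^ kk) (m₀ := coverMargin L m) hM hM' hw hfit1 hS ha k)
  have hχ := chiCube_coverCorner_eq_one_side (M := M) (n := L ^ kk) (m₀ := coverMargin L m) hM hw hfit1 hS 0 k
  have hχ' := chiCube_coverCorner_eq_one_side (M := M) (n := L ^ r * L ^ kk) (m₀ := coverMargin L m) hM hw hfit1 hS 0 k
  have hT : ∀ {nn : ℕ} [NeZero nn] (hχn : ∀ x : Tor (fine nn M) × Fin (d + 1), (∃ x₀, (x₀ = x ∨ x₀ = bshiftEquiv M nn 0 x ∨ x₀ = (bshiftEquiv M nn 0).symm x) ∧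
        ∀ ν, |cenRep (2 * L) (coverXi M nn (L ^ m) ν x₀ - ((k ν).val : ℝ))| < 1) → chiCube M nn c (L * L ^ m) x = 1),
      mulOp (chiCube M nn c (L * L ^ m)) ∘ₗ mulOp (hcube (2 * L) (coverXi M nn (L ^ m)) k) ∘ₗ mulOp (chiCube M nn c (L * L ^ m)) = mulOp (hcube (2 * L) (coverXi M nn (L ^ m)) k) :=
    fun hχn => by
    refine LinearMap.ext fun f => funext fun x => ?_
    simp only [LinearMap.comp_apply, mulOp_apply]
    by_cases h0 : hcube (2 * L) (coverXi M _ (L ^ m)) k x = 0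
    · rw [h0, zero_mul, zero_mul, mul_zero]
    · rw [chi_eq_one_of_hcube_ne_zero (2 * L) (coverXi M _ (L ^ m)) (bshiftEquiv M _) 0 hχn (Or.inl rfl) h0, one_mul, one_mul]
  have h1 : ∀ x : Tor (fine (L ^ kk) M) × Fin (d + 1), chiCube M (L ^ kk) c (L * L ^ m) x ≠ 0 → blockOf (L ^ kk) M x.1 ∈ ((cubeBlocks M c (L * L ^ m) : Finset (Tor M)) : Set (Tor M)) :=
    fun x hx => by
    unfold chiCube at hx
    by_contra hb
    exact hx (if_neg (fun hmem => hb (Finset.mem_coe.mpr hmem)))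
  have h2 : ∀ x' : Tor (fine (L ^ r * L ^ kk) M) × Fin (d + 1), chiCube M (L ^ r * L ^ kk) c (L * L ^ m) x' ≠ 0 →
      ((fun b : Tor (fine (L ^ kk) M) × Fin (d + 1) => blockOf (L ^ kk) M b.1) ∘ kingPrV L kk r M) x' ∈ ((cubeBlocks M c (L * L ^ m) : Finset (Tor M)) : Set (Tor M)) :=
    fun x' hx => by
    rw [← hblk]
    unfold chiCube at hx
    by_contra hb
    exact hx (if_neg (fun hmem => hb (Finset.mem_coe.mpr hmem)))
  have hR : HasMaj (BlockNorm.ofBlocks (unitTorusGeo L kk M) (fun b : Tor (fine (L ^ kk) M) × Fin (d + 1) => blockOf (L ^ kk) M b.1))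
      (BlockNorm.ofBlocks (unitTorusGeo L kk M) ((fun b : Tor (fine (L ^ kk) M) × Fin (d + 1) => blockOf (L ^ kk) M b.1) ∘ kingPrV L kk r M))
      (idef (pull (kingPrV L kk r M)) (pull (kingPrV L kk r M)) (mulOp (hcube (2 * L) (coverXi M (L ^ r * L ^ kk) (L ^ m)) k)) (mulOp (hcube (2 * L) (coverXi M (L ^ kk) (L ^ m)) k)))
      (fun y y' => π * (d + 1) / (((L ^ kk : ℕ) : ℝ) * ((L ^ m : ℕ) : ℝ)) * Real.exp (-(δ * tdistT M y y'))) := by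
    refine (hasMaj_idef_mulOp (g := unitTorusGeo L kk M) (fun b : Tor (fine (L ^ kk) M) × Fin (d + 1) => blockOf (L ^ kk) M b.1) (kingPrV L kk r M)
      (o := fun _ => π * (d + 1) / (((L ^ kk : ℕ) : ℝ) * ((L ^ m : ℕ) : ℝ))) (fun _ => by positivity)
      (fun x' => abs_coverH_fine_sub_le (L := L) (kk := kk) (r := r) hM hw k x')).mono fun y y' => ?_
    have h := diagK_le_decay (g := unitTorusGeo L kk M) (o := fun _ => π * (d + 1) / (((L ^ kk : ℕ) : ℝ) * ((L ^ m : ℕ) : ℝ))) (w := fun _ => (1 : ℝ))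
      (ε := π * (d + 1) / (((L ^ kk : ℕ) : ℝ) * ((L ^ m : ℕ) : ℝ))) δ (fun _ => by positivity) (fun _ => by rw [mul_one]) (unitTorusGeo_dist_self L kk M) y y'
    simpa using h
  have t1 := hasMaj_localize_idef_sandwich (g := unitTorusGeo L kk M) (fun b : Tor (fine (L ^ kk) M) × Fin (d + 1) => blockOf (L ^ kk) M b.1) (kingPrV L kk r M)
    (fun y y' => mul_nonneg (by positivity) (Real.exp_nonneg _)) (hT hχ) (hT hχ') h1 h2 hR
  have hG := hasMaj_gOp_of_ineq (L := L) (k := kk) M (L ^ kk) a hn (H (m + 1) kk r hk).1 hC.le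
  have hNL := hasMaj_nonlocalPart (L := L) (kk := kk) (M := M) (n := L ^ kk) (a := a) hC₁.le hδm.le (min_le_right δ₀ δ₁) (HL kk (L ^ kk) M)
  have hYc : HasMaj (BlockNorm.ofBlocks (unitTorusGeo L kk M) (fun b : Tor (fine (L ^ kk) M) × Fin (d + 1) => blockOf (L ^ kk) M b.1))
      (BlockNorm.ofBlocks (unitTorusGeo L kk M) (fun b : Tor (fine (L ^ kk) M) × Fin (d + 1) => blockOf (L ^ kk) M b.1))
      (mulOp (chiCube M (L ^ kk) c (L * L ^ m)) ∘ₗ (a • (qvAdjRe M (L ^ kk) ∘ₗ qvRe M (L ^ kk)) + (-landauRe M (L ^ kk))) ∘ₗ neumannCubeG M (L ^ kk) c (L * L ^ m) a)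
      (fun y y' => ind ((cubeBlocks M c (L * L ^ m) : Finset (Tor M)) : Set (Tor M)) y * ind ((cubeBlocks M c (L * L ^ m) : Finset (Tor M)) : Set (Tor M)) y' * (βY * Real.exp (-(δ * tdistT M y y')))) :=
    hasMaj_rate_le hind hβY hdm
      (hasMaj_chiCube_comp_neumannCubeG (c := c) (S := L * L ^ m) (a := a) hM' (triangle254_unitTorusGeo L kk M) hrow hC.le hδ₀.le hcN
        (by positivity : 0 ≤ δm / 2) (by linarith [min_le_left δ₀ δ₁] : δm / 2 ≤ δ₀) (by linarith : δm / 2 + δm / 4 ≤ δm) hNL hG)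
  have hIY0 := HY m kk r hk hn4 k
  have hIY : HasMaj (BlockNorm.ofBlocks (unitTorusGeo L kk M) (fun b : Tor (fine (L ^ kk) M) × Fin (d + 1) => blockOf (L ^ kk) M b.1))
      (BlockNorm.ofBlocks (unitTorusGeo L kk M) ((fun b : Tor (fine (L ^ kk) M) × Fin (d + 1) => blockOf (L ^ kk) M b.1) ∘ kingPrV L kk r M))
      (idef (pull (kingPrV L kk r M)) (pull (kingPrV L kk r M))
        (mulOp (chiCube M (L ^ r * L ^ kk) c (L * L ^ m)) ∘ₗ (a • (qvAdjRe M (L ^ r * L ^ kk) ∘ₗ qvRe M (L ^ r * L ^ kk)) + (-landauRe M (L ^ r * L ^ kk))) ∘ₗ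
          neumannCubeG M (L ^ r * L ^ kk) c (L * L ^ m) a)
        (mulOp (chiCube M (L ^ kk) c (L * L ^ m)) ∘ₗ (a • (qvAdjRe M (L ^ kk) ∘ₗ qvRe M (L ^ kk)) + (-landauRe M (L ^ kk))) ∘ₗ neumannCubeG M (L ^ kk) c (L * L ^ m) a))
      (fun y y' => ind ((cubeBlocks M c (L * L ^ m) : Finset (Tor M)) : Set (Tor M)) y * ind ((cubeBlocks M c (L * L ^ m) : Finset (Tor M)) : Set (Tor M)) y' *
        (mY * ε * Real.exp (-(δ * tdistT M y y')))) := by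
    have h2 := hasMaj_rate_le hind (by positivity : 0 ≤ mY * ε) hdY hIY0
    rw [hblk] at h2
    exact h2
  have t2 := hasMaj_idef_mulOp_comp_loc (g := unitTorusGeo L kk M) (fun b : Tor (fine (L ^ kk) M) × Fin (d + 1) => blockOf (L ^ kk) M b.1) (kingPrV L kk r M)
    (a := hcube (2 * L) (coverXi M (L ^ kk) (L ^ m)) k) (a' := hcube (2 * L) (coverXi M (L ^ r * L ^ kk) (L ^ m)) k) zero_le_one
    (by positivity : (0 : ℝ) ≤ π * (d + 1) / (((L ^ kk : ℕ) : ℝ) * ((L ^ m : ℕ) : ℝ))) (fun x' => abs_coverH_le_one k x')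
    (fun x' => abs_coverH_fine_sub_le (L := L) (kk := kk) (r := r) hM hw k x') hYc hIY
  -- assembly
  have t : HasMaj (BlockNorm.ofBlocks (unitTorusGeo L kk M) (fun b : Tor (fine (L ^ kk) M) × Fin (d + 1) => blockOf (L ^ kk) M b.1))
      (BlockNorm.ofBlocks (unitTorusGeo L kk M) ((fun b : Tor (fine (L ^ kk) M) × Fin (d + 1) => blockOf (L ^ kk) M b.1) ∘ kingPrV L kk r M))
      (idef (pull (kingPrV L kk r M)) (pull (kingPrV L kk r M))
        (mulOp (hcube (2 * L) (coverXi M (L ^ r * L ^ kk) (L ^ m)) k) -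
          mulOp (hcube (2 * L) (coverXi M (L ^ r * L ^ kk) (L ^ m)) k) ∘ₗ (mulOp (chiCube M (L ^ r * L ^ kk) c (L * L ^ m)) ∘ₗ
            (a • (qvAdjRe M (L ^ r * L ^ kk) ∘ₗ qvRe M (L ^ r * L ^ kk)) + (-landauRe M (L ^ r * L ^ kk))) ∘ₗ neumannCubeG M (L ^ r * L ^ kk) c (L * L ^ m) a))
        (mulOp (hcube (2 * L) (coverXi M (L ^ kk) (L ^ m)) k) -
          mulOp (hcube (2 * L) (coverXi M (L ^ kk) (L ^ m)) k) ∘ₗ (mulOp (chiCube M (L ^ kk) c (L * L ^ m)) ∘ₗ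
            (a • (qvAdjRe M (L ^ kk) ∘ₗ qvRe M (L ^ kk)) + (-landauRe M (L ^ kk))) ∘ₗ neumannCubeG M (L ^ kk) c (L * L ^ m) a)))
      (fun y y' => ind ((cubeBlocks M c (L * L ^ m) : Finset (Tor M)) : Set (Tor M)) y * ind ((cubeBlocks M c (L * L ^ m) : Finset (Tor M)) : Set (Tor M)) y' *
        ((Ko + (mY + Ko * βY) + 1) * ε * Real.exp (-(δ * tdistT M y y')))) := by
    rw [idef_sub]
    refine (t1.sub t2).mono fun y y' => ?_
    have ho : π * (d + 1) / (((L ^ kk : ℕ) : ℝ) * ((L ^ m : ℕ) : ℝ)) ≤ Ko * ε := by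
      rw [div_eq_mul_inv]; exact mul_le_mul_of_nonneg_left hnwε (by positivity)
    have hI := hind y y'
    have hIle : ind (g := unitTorusGeo L kk M) ((cubeBlocks M c (L * L ^ m) : Finset (Tor M)) : Set (Tor M)) y *
        ind (g := unitTorusGeo L kk M) ((cubeBlocks M c (L * L ^ m) : Finset (Tor M)) : Set (Tor M)) y' ≤ 1 :=
      (mul_le_mul (ind_le_one _ _) (ind_le_one _ _) (ind_nonneg _ _) zero_le_one).trans (by rw [one_mul])
    have hE := Real.exp_nonneg (-(δ * tdistT M y y'))
    have hb : 1 * (mY * ε) + π * (d + 1) / (((L ^ kk : ℕ) : ℝ) * ((L ^ m : ℕ) : ℝ)) * βY ≤ (mY + Ko * βY) * ε := by nlinarith [mul_le_mul_of_nonneg_right ho hβY]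
    calc ind (g := unitTorusGeo L kk M) ((cubeBlocks M c (L * L ^ m) : Finset (Tor M)) : Set (Tor M)) y *
            ind (g := unitTorusGeo L kk M) ((cubeBlocks M c (L * L ^ m) : Finset (Tor M)) : Set (Tor M)) y' *
            (π * (d + 1) / (((L ^ kk : ℕ) : ℝ) * ((L ^ m : ℕ) : ℝ)) * Real.exp (-(δ * tdistT M y y'))) +
          ind (g := unitTorusGeo L kk M) ((cubeBlocks M c (L * L ^ m) : Finset (Tor M)) : Set (Tor M)) y *
            ind (g := unitTorusGeo L kk M) ((cubeBlocks M c (L * L ^ m) : Finset (Tor M)) : Set (Tor M)) y' *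
            ((1 * (mY * ε) + π * (d + 1) / (((L ^ kk : ℕ) : ℝ) * ((L ^ m : ℕ) : ℝ)) * βY) * Real.exp (-(δ * tdistT M y y')))
        = ind (g := unitTorusGeo L kk M) ((cubeBlocks M c (L * L ^ m) : Finset (Tor M)) : Set (Tor M)) y *
            ind (g := unitTorusGeo L kk M) ((cubeBlocks M c (L * L ^ m) : Finset (Tor M)) : Set (Tor M)) y' *
            ((π * (d + 1) / (((L ^ kk : ℕ) : ℝ) * ((L ^ m : ℕ) : ℝ)) + (1 * (mY * ε) + π * (d + 1) / (((L ^ kk : ℕ) : ℝ) * ((L ^ m : ℕ) : ℝ)) * βY)) *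
              Real.exp (-(δ * tdistT M y y'))) := by ring
      _ ≤ _ := by
        refine mul_le_mul_of_nonneg_left (mul_le_mul_of_nonneg_right ?_ hE) hI
        nlinarith [ho, hb, hε0]
  rw [← hblk] at t
  exact t.congr fun f => (LinearMap.congr_fun E f).symm

end WeightedDefect

/-! ## §3 The two-grid defect `𝔇((Σ∇′*∇′)G₀′, (Σ∇*∇)G₀)` -/

section TwoGrid

variable {L : ℕ} [NeZero L]

/-- ★★★ **THE TWO-GRID η-DEFECT OF ENTRY 3 OF THE COVER's PARAMETRIX ON THE DOUBLED TORUS**: for odd `L ≥ 3`, `a > 0` there are `δ, D > 0` (uniform in `m, k, r`) with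
`𝔇((Σ∇′*∇′)∘G₀′, (Σ∇*∇)∘G₀) ≤ D·(L^k)^{−1∕16}·e^{−δ|y−y′|_T}` for `k ≥ 1`, `4 ≤ L^k` — FILE 83 `hasMaj_idef_comp_parametrix_of_commOp_h` with FILE 86's weighted rows, §2's weighted-row
defect, FILE 72's fine commutator rows and FILE 87's commutator defect, every row a tree theorem. [cite: Balaban1984PropagatorsII, (2.133)–(2.136) p.247 (shapes), (2.36)–(2.38) p.229;
Balaban1985BackgroundPropagators, Thm 3.14 pp.426–427 (difference template), (3.42) p.397 (entry 3: shape); King1986, Prop. 3.9 (3.73) p.665 (rate shape)] -/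
theorem hasMaj_idef_lap_parametrix_knit (hL : Odd L ∧ 1 < L) {a : ℝ} (ha : 0 < a) :
    ∃ δ D : ℝ, 0 < δ ∧ 0 < D ∧ ∀ (m kk r : ℕ) (_hk : 1 ≤ kk) (_hn4 : 4 ≤ L ^ kk),
      HasMaj (BlockNorm.ofBlocks (unitTorusGeo L kk (MP (paramsOf d L (m + 1) kk hL)))
          (fun b : Tor (fine (L ^ kk) (MP (paramsOf d L (m + 1) kk hL))) × Fin (d + 1) => blockOf (L ^ kk) (MP (paramsOf d L (m + 1) kk hL)) b.1))
        (BlockNorm.ofBlocks (unitTorusGeo L kk (MP (paramsOf d L (m + 1) kk hL)))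
          (fun i : Tor (fine (L ^ r * L ^ kk) (MP (paramsOf d L (m + 1) kk hL))) × Fin (d + 1) => blockOf (L ^ r * L ^ kk) (MP (paramsOf d L (m + 1) kk hL)) i.1))
        (idef (pull (kingPrV L kk r (MP (paramsOf d L (m + 1) kk hL)))) (pull (kingPrV L kk r (MP (paramsOf d L (m + 1) kk hL))))
          (lapOp ((L ^ r * L ^ kk : ℕ) : ℝ) (bshiftEquiv (MP (paramsOf d L (m + 1) kk hL)) (L ^ r * L ^ kk)) 0 ∘ₗ
            parametrix (knitH d L m kk (L ^ r * L ^ kk) hL) (knitG d L m kk (L ^ r * L ^ kk) hL a))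
          (lapOp ((L ^ kk : ℕ) : ℝ) (bshiftEquiv (MP (paramsOf d L (m + 1) kk hL)) (L ^ kk)) 0 ∘ₗ
            parametrix (knitH d L m kk (L ^ kk) hL) (knitG d L m kk (L ^ kk) hL a)))
        (fun y y' => D * ((L ^ kk : ℕ) : ℝ) ^ (-(1 / 16 : ℝ)) * Real.exp (-(δ * tdistT (MP (paramsOf d L (m + 1) kk hL)) y y'))) := by
  have hL3 : 3 ≤ L := by obtain ⟨⟨j, hj⟩, h1⟩ := hL; omega
  have hLpos : 0 < L := by omega
  obtain ⟨δ₀, C, Cα, Cε, Cαε, hδ₀, hC, H⟩ := ineq110_114_pair (d := d) hL ha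
  obtain ⟨δ₁, C₁, hδ₁, hC₁, HL⟩ := hasMaj_landauRe (d := d) (L := L)
  obtain ⟨δD, βD, hδD, hβD, HD⟩ := hasMaj_chiCube_grad_neumannCubeG_fine (d := d) hL ha
  obtain ⟨δB, βB, hδB, hβB, HB⟩ := hasMaj_chiCube_divAdjOut_neumannCubeG_pair (d := d) hL ha
  obtain ⟨δ3, m3, hδ3, hm3, H3⟩ := hasMaj_idef_mulOp_coverH_lap_knitG (d := d) hL ha
  obtain ⟨δ7, Cr, hδ7, hCr, H7⟩ := hasMaj_idef_commOp_lapOp_comp_knitG (d := d) hL ha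
  set δm : ℝ := min δ₀ δ₁ with hδm_def
  have hδm : 0 < δm := lt_min hδ₀ hδ₁
  set δ : ℝ := min (min (δm / 2) (min δD δB)) (min δ3 δ7) with hδ_def
  have hδ : 0 < δ := lt_min (lt_min (by positivity) (lt_min hδD hδB)) (lt_min hδ3 hδ7)
  have hdm : δ ≤ δm / 2 := (min_le_left _ _).trans (min_le_left _ _)
  have hd0 : δ ≤ δ₀ := hdm.trans (by linarith [min_le_left δ₀ δ₁])
  have hdD : δ ≤ δD := (min_le_left _ _).trans ((min_le_right _ _).trans (min_le_left _ _))
  have hdB : δ ≤ δB := (min_le_left _ _).trans ((min_le_right _ _).trans (min_le_right _ _))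
  have hd3 : δ ≤ δ3 := (min_le_right _ _).trans (min_le_left _ _)
  have hd7 : δ ≤ δ7 := (min_le_right _ _).trans (min_le_right _ _)
  set cr : ℝ := B4Sect5Proof.latticeConst (d + 1) (δm / 4) with hcr_def
  have hcr : 0 ≤ cr := B4Sect5Proof.latticeConst_nonneg (d + 1) (by positivity)
  set β : ℝ := 2 ^ (d + 1) * (C * Real.exp δ₀) with hβ_def
  have hβ : 0 ≤ β := by positivity
  set β₁ : ℝ := max βD βB with hβ₁_def
  have hβ₁ : 0 ≤ β₁ := hβD.le.trans (le_max_left _ _)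
  set cN : ℝ := |a| * (Real.exp δm * Real.exp δm) + C₁ with hcN_def
  have hcN : 0 ≤ cN := by positivity
  set β₃ : ℝ := 1 + 2 ^ (d + 1) * (cN * (C * Real.exp δ₀) * cr) with hβ₃_def
  have hβ₃ : 0 ≤ β₃ := by positivity
  set Θ : ℝ := (d + 1 : ℕ) * (32 * π ^ 2 * β + 2 * (π * β₁)) with hΘ_def
  have hΘ : 0 ≤ Θ := by positivity
  set Nov : ℝ := (((2 * L) ^ (d + 1) : ℕ) : ℝ) with hNov_def
  set Ko : ℝ := π * (d + 1) with hKo_def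
  set D : ℝ := Nov * ((β₃ * Ko + m3) + (Θ * Ko + Cr)) + 1 with hD_def
  refine ⟨δ, D, hδ, by positivity, fun m kk r hk hn4 => ?_⟩
  set M : Fin (d + 1) → ℕ := MP (paramsOf d L (m + 1) kk hL) with hMdef
  have hM : ∀ ν, M ν = 2 * L * L ^ m := MP_succ_eq L m kk hL
  have hM' : ∀ ν, M ν = 2 * (L * L ^ m) := fun ν => by rw [hM ν, mul_assoc]
  have hw : 0 < L ^ m := pow_pos hLpos m
  have hn : 1 ≤ L ^ kk := Nat.one_le_pow _ _ hLpos
  have hn' : 1 ≤ L ^ r * L ^ kk := Nat.one_le_iff_ne_zero.mpr (Nat.mul_ne_zero (pow_ne_zero r (NeZero.ne L)) (pow_ne_zero kk (NeZero.ne L)))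
  have hfit := coverMargin_fit hL3 m
  have hfit1 : coverMargin L m + 2 * L ^ m + 1 ≤ L * L ^ m := by omega
  have hS : L * L ^ m ≤ 2 * L * L ^ m := by rw [mul_assoc]; omega
  have hSe : L ^ (m + 1) = L * L ^ m := by rw [pow_succ, mul_comm]
  have hwR : (1 : ℝ) ≤ ((L ^ m : ℕ) : ℝ) := by exact_mod_cast hw
  have hnR : (1 : ℝ) ≤ ((L ^ kk : ℕ) : ℝ) := by exact_mod_cast hn
  set ε : ℝ := ((L ^ kk : ℕ) : ℝ) ^ (-(1 / 16 : ℝ)) with hε_def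
  obtain ⟨-, hnwε, -, hε0⟩ := rpow_sixteenth_facts hnR hwR
  have hrow := rowSum_unitTorusGeo (L := L) (k := kk) (M := M) (σ := δm / 4) (by positivity)
  have hblk : (fun i : Tor (fine (L ^ r * L ^ kk) M) × Fin (d + 1) => blockOf (L ^ r * L ^ kk) M i.1) =
      (fun b : Tor (fine (L ^ kk) M) × Fin (d + 1) => blockOf (L ^ kk) M b.1) ∘ kingPrV L kk r M := (VectorPiece.blkFine_comp_kingPrV (M := M) L kk r).symm
  have hind : ∀ (k : Fin (d + 1) → ZMod (2 * L)) (y y' : Tor M),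
      0 ≤ ind (g := unitTorusGeo L kk M) ((cubeBlocks M (coverCorner M (L ^ m) L (coverMargin L m) k) (L * L ^ m) : Finset (Tor M)) : Set (Tor M)) y *
        ind (g := unitTorusGeo L kk M) ((cubeBlocks M (coverCorner M (L ^ m) L (coverMargin L m) k) (L * L ^ m) : Finset (Tor M)) : Set (Tor M)) y' :=
    fun k y y' => mul_nonneg (ind_nonneg _ _) (ind_nonneg _ _)
  -- the fine weighted rows (FILE 86 §1)
  have hG' := hasMaj_gOp_of_ineq (L := L) (k := kk) M (L ^ r * L ^ kk) a hn' (H (m + 1) kk r hk).2 hC.le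
  have hNL' := hasMaj_nonlocalPart (L := L) (kk := kk) (M := M) (n := L ^ r * L ^ kk) (a := a) hC₁.le hδm.le (min_le_right δ₀ δ₁) (HL kk (L ^ r * L ^ kk) M)
  have hE3 : ∀ k : Fin (d + 1) → ZMod (2 * L),
      HasMaj (BlockNorm.ofBlocks (unitTorusGeo L kk M) ((fun b : Tor (fine (L ^ kk) M) × Fin (d + 1) => blockOf (L ^ kk) M b.1) ∘ kingPrV L kk r M))
        (BlockNorm.ofBlocks (unitTorusGeo L kk M) ((fun b : Tor (fine (L ^ kk) M) × Fin (d + 1) => blockOf (L ^ kk) M b.1) ∘ kingPrV L kk r M))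
        (mulOp (knitH d L m kk (L ^ r * L ^ kk) hL k) ∘ₗ (lapOp ((L ^ r * L ^ kk : ℕ) : ℝ) (bshiftEquiv M (L ^ r * L ^ kk)) 0 ∘ₗ knitG d L m kk (L ^ r * L ^ kk) hL a k))
        (fun y y' => ind ((cubeBlocks M (coverCorner M (L ^ m) L (coverMargin L m) k) (L * L ^ m) : Finset (Tor M)) : Set (Tor M)) y *
          ind ((cubeBlocks M (coverCorner M (L ^ m) L (coverMargin L m) k) (L * L ^ m) : Finset (Tor M)) : Set (Tor M)) y' * (β₃ * Real.exp (-(δ * tdistT M y y')))) := fun k => by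
    rw [← hblk]
    exact hasMaj_rate_le (hind k) hβ₃ hdm
      (hasMaj_mulOp_coverH_lap_knitG (L := L) (kk := kk) (n := L ^ r * L ^ kk) (m₀ := coverMargin L m) hM hM' hw hfit1 hS ha k hrow hC.le hδ₀.le hcN
        (by positivity : 0 ≤ δm / 2) (by linarith [min_le_left δ₀ δ₁] : δm / 2 ≤ δ₀) (by linarith : δm / 2 + δm / 4 ≤ δm) hG' hNL')
  -- the fine commutator rows (FILE 72)
  have hGc' : ∀ k : Fin (d + 1) → ZMod (2 * L),
      HasMaj (BlockNorm.ofBlocks (unitTorusGeo L kk M) (fun i : Tor (fine (L ^ r * L ^ kk) M) × Fin (d + 1) => blockOf (L ^ r * L ^ kk) M i.1))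
        (BlockNorm.ofBlocks (unitTorusGeo L kk M) (fun i : Tor (fine (L ^ r * L ^ kk) M) × Fin (d + 1) => blockOf (L ^ r * L ^ kk) M i.1))
        (mulOp (chiCube M (L ^ r * L ^ kk) (coverCorner M (L ^ m) L (coverMargin L m) k) (L * L ^ m)) ∘ₗ knitG d L m kk (L ^ r * L ^ kk) hL a k)
        (fun y y' => ind ((cubeBlocks M (coverCorner M (L ^ m) L (coverMargin L m) k) (L * L ^ m) : Finset (Tor M)) : Set (Tor M)) y *
          ind ((cubeBlocks M (coverCorner M (L ^ m) L (coverMargin L m) k) (L * L ^ m) : Finset (Tor M)) : Set (Tor M)) y' * (β * Real.exp (-(δ * tdistT M y y')))) := fun k =>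
    hasMaj_rate_le (hind k) hβ hd0
      (hasMaj_chiCube_symOp_comp (L := L) (k := kk) (c := coverCorner M (L ^ m) L (coverMargin L m) k) (S := L * L ^ m) hC.le hδ₀.le hM'
        (hasMaj_comp_mulOp_chiInt (c := coverCorner M (L ^ m) L (coverMargin L m) k) (S := L * L ^ m) hC.le hG'))
  have hDc' : ∀ (k : Fin (d + 1) → ZMod (2 * L)) (μ : Fin (d + 1)),
      HasMaj (BlockNorm.ofBlocks (unitTorusGeo L kk M) (fun i : Tor (fine (L ^ r * L ^ kk) M) × Fin (d + 1) => blockOf (L ^ r * L ^ kk) M i.1))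
        (BlockNorm.ofBlocks (unitTorusGeo L kk M) (fun i : Tor (fine (L ^ r * L ^ kk) M) × Fin (d + 1) => blockOf (L ^ r * L ^ kk) M i.1))
        (mulOp (chiCube M (L ^ r * L ^ kk) (coverCorner M (L ^ m) L (coverMargin L m) k) (L * L ^ m)) ∘ₗ
          (fgrad ((L ^ r * L ^ kk : ℕ) : ℝ) (bshiftEquiv M (L ^ r * L ^ kk) μ) ∘ₗ knitG d L m kk (L ^ r * L ^ kk) hL a k))
        (fun y y' => ind ((cubeBlocks M (coverCorner M (L ^ m) L (coverMargin L m) k) (L * L ^ m) : Finset (Tor M)) : Set (Tor M)) y *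
          ind ((cubeBlocks M (coverCorner M (L ^ m) L (coverMargin L m) k) (L * L ^ m) : Finset (Tor M)) : Set (Tor M)) y' * (β₁ * Real.exp (-(δ * tdistT M y y')))) :=
    fun k μ => by
    have h := HD (m + 1) kk r hk (coverCorner M (L ^ m) L (coverMargin L m) k) μ
    rw [hSe, symbOp_sD_eq] at h
    exact (hasMaj_rate_le (hind k) hβD.le hdD h).mono fun y y' =>
      mul_le_mul_of_nonneg_left (mul_le_mul_of_nonneg_right (le_max_left _ _) (Real.exp_nonneg _)) (hind k y y')
  have hDbc' : ∀ (k : Fin (d + 1) → ZMod (2 * L)) (μ : Fin (d + 1)),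
      HasMaj (BlockNorm.ofBlocks (unitTorusGeo L kk M) (fun i : Tor (fine (L ^ r * L ^ kk) M) × Fin (d + 1) => blockOf (L ^ r * L ^ kk) M i.1))
        (BlockNorm.ofBlocks (unitTorusGeo L kk M) (fun i : Tor (fine (L ^ r * L ^ kk) M) × Fin (d + 1) => blockOf (L ^ r * L ^ kk) M i.1))
        (mulOp (chiCube M (L ^ r * L ^ kk) (coverCorner M (L ^ m) L (coverMargin L m) k) (L * L ^ m)) ∘ₗ
          (bgrad ((L ^ r * L ^ kk : ℕ) : ℝ) (bshiftEquiv M (L ^ r * L ^ kk) μ) ∘ₗ knitG d L m kk (L ^ r * L ^ kk) hL a k))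
        (fun y y' => ind ((cubeBlocks M (coverCorner M (L ^ m) L (coverMargin L m) k) (L * L ^ m) : Finset (Tor M)) : Set (Tor M)) y *
          ind ((cubeBlocks M (coverCorner M (L ^ m) L (coverMargin L m) k) (L * L ^ m) : Finset (Tor M)) : Set (Tor M)) y' * (β₁ * Real.exp (-(δ * tdistT M y y')))) :=
    fun k μ => by
    have h := (HB (m + 1) kk r hk (coverCorner M (L ^ m) L (coverMargin L m) k) μ).2
    rw [hSe] at h
    rw [bgrad_eq_neg_symbOp, LinearMap.neg_comp, LinearMap.comp_neg]
    exact ((hasMaj_rate_le (hind k) hβB.le hdB h).mono fun y y' =>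
      mul_le_mul_of_nonneg_left (mul_le_mul_of_nonneg_right (le_max_right _ _) (Real.exp_nonneg _)) (hind k y y')).neg
  have hKc' : ∀ k : Fin (d + 1) → ZMod (2 * L),
      HasMaj (BlockNorm.ofBlocks (unitTorusGeo L kk M) ((fun b : Tor (fine (L ^ kk) M) × Fin (d + 1) => blockOf (L ^ kk) M b.1) ∘ kingPrV L kk r M))
        (BlockNorm.ofBlocks (unitTorusGeo L kk M) ((fun b : Tor (fine (L ^ kk) M) × Fin (d + 1) => blockOf (L ^ kk) M b.1) ∘ kingPrV L kk r M))
        (commOp (lapOp ((L ^ r * L ^ kk : ℕ) : ℝ) (bshiftEquiv M (L ^ r * L ^ kk)) 0) (knitH d L m kk (L ^ r * L ^ kk) hL k) ∘ₗ knitG d L m kk (L ^ r * L ^ kk) hL a k)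
        (fun y y' => ind ((cubeBlocks M (coverCorner M (L ^ m) L (coverMargin L m) k) (L * L ^ m) : Finset (Tor M)) : Set (Tor M)) y *
          ind ((cubeBlocks M (coverCorner M (L ^ m) L (coverMargin L m) k) (L * L ^ m) : Finset (Tor M)) : Set (Tor M)) y' * (Θ * Real.exp (-(δ * tdistT M y y')))) := fun k => by
    rw [← hblk]
    have h := hasMaj_commOp_lapOp_comp_cover_of (L := L) (kk := kk) (M := M) (n := L ^ r * L ^ kk) hM hw hfit1 hS k (hGc' k) (hDc' k) (hDbc' k)
    refine h.mono fun y y' => mul_le_mul_of_nonneg_left (mul_le_mul_of_nonneg_right ?_ (Real.exp_nonneg _)) (hind k y y')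
    have h32 : 32 * π ^ 2 / ((L ^ m : ℕ) : ℝ) ^ 2 * β ≤ 32 * π ^ 2 * β := by
      refine mul_le_mul_of_nonneg_right (div_le_self (by positivity) ?_) hβ
      nlinarith
    have hπ : π / ((L ^ m : ℕ) : ℝ) * β₁ ≤ π * β₁ := mul_le_mul_of_nonneg_right (div_le_self Real.pi_pos.le hwR) hβ₁
    rw [hΘ_def, add_zero]
    exact mul_le_mul_of_nonneg_left (by linarith) (by positivity)
  -- the defects: weighted row (§2) and commutator (FILE 87)
  have hIE3 : ∀ k : Fin (d + 1) → ZMod (2 * L),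
      HasMaj (BlockNorm.ofBlocks (unitTorusGeo L kk M) (fun b : Tor (fine (L ^ kk) M) × Fin (d + 1) => blockOf (L ^ kk) M b.1))
        (BlockNorm.ofBlocks (unitTorusGeo L kk M) ((fun b : Tor (fine (L ^ kk) M) × Fin (d + 1) => blockOf (L ^ kk) M b.1) ∘ kingPrV L kk r M))
        (idef (pull (kingPrV L kk r M)) (pull (kingPrV L kk r M))
          (mulOp (knitH d L m kk (L ^ r * L ^ kk) hL k) ∘ₗ (lapOp ((L ^ r * L ^ kk : ℕ) : ℝ) (bshiftEquiv M (L ^ r * L ^ kk)) 0 ∘ₗ knitG d L m kk (L ^ r * L ^ kk) hL a k))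
          (mulOp (knitH d L m kk (L ^ kk) hL k) ∘ₗ (lapOp ((L ^ kk : ℕ) : ℝ) (bshiftEquiv M (L ^ kk)) 0 ∘ₗ knitG d L m kk (L ^ kk) hL a k)))
        (fun y y' => ind ((cubeBlocks M (coverCorner M (L ^ m) L (coverMargin L m) k) (L * L ^ m) : Finset (Tor M)) : Set (Tor M)) y *
          ind ((cubeBlocks M (coverCorner M (L ^ m) L (coverMargin L m) k) (L * L ^ m) : Finset (Tor M)) : Set (Tor M)) y' * (m3 * ε * Real.exp (-(δ * tdistT M y y')))) := fun k => by
    have h := hasMaj_rate_le (hind k) (by positivity : 0 ≤ m3 * ε) hd3 (H3 m kk r hk hn4 k)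
    rw [hblk] at h
    exact h
  have hDK : ∀ k : Fin (d + 1) → ZMod (2 * L),
      HasMaj (BlockNorm.ofBlocks (unitTorusGeo L kk M) (fun b : Tor (fine (L ^ kk) M) × Fin (d + 1) => blockOf (L ^ kk) M b.1))
        (BlockNorm.ofBlocks (unitTorusGeo L kk M) ((fun b : Tor (fine (L ^ kk) M) × Fin (d + 1) => blockOf (L ^ kk) M b.1) ∘ kingPrV L kk r M))
        (idef (pull (kingPrV L kk r M)) (pull (kingPrV L kk r M))
          (commOp (lapOp ((L ^ r * L ^ kk : ℕ) : ℝ) (bshiftEquiv M (L ^ r * L ^ kk)) 0) (knitH d L m kk (L ^ r * L ^ kk) hL k) ∘ₗ knitG d L m kk (L ^ r * L ^ kk) hL a k)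
          (commOp (lapOp ((L ^ kk : ℕ) : ℝ) (bshiftEquiv M (L ^ kk)) 0) (knitH d L m kk (L ^ kk) hL k) ∘ₗ knitG d L m kk (L ^ kk) hL a k))
        (fun y y' => ind ((cubeBlocks M (coverCorner M (L ^ m) L (coverMargin L m) k) (L * L ^ m) : Finset (Tor M)) : Set (Tor M)) y *
          ind ((cubeBlocks M (coverCorner M (L ^ m) L (coverMargin L m) k) (L * L ^ m) : Finset (Tor M)) : Set (Tor M)) y' * (Cr * ε * Real.exp (-(δ * tdistT M y y')))) := fun k => by
    have h := hasMaj_rate_le (hind k) (by positivity : 0 ≤ Cr * ε) hd7 (H7 m kk r hk hn4 k)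
    rw [hblk] at h
    exact h
  have hh : ∀ (k : Fin (d + 1) → ZMod (2 * L)) x, |knitH d L m kk (L ^ kk) hL k x| ≤ 1 := fun k x => abs_coverH_le_one k x
  have hfitH : ∀ (k : Fin (d + 1) → ZMod (2 * L)) x', |knitH d L m kk (L ^ r * L ^ kk) hL k x' - knitH d L m kk (L ^ kk) hL k (kingPrV L kk r M x')| ≤
      π * (d + 1) / (((L ^ kk : ℕ) : ℝ) * ((L ^ m : ℕ) : ℝ)) := fun k x' => abs_coverH_fine_sub_le (L := L) (kk := kk) (r := r) hM hw k x'
  have hN := fun y => sum_ind_cubeBlocks_le (M := M) (w := L ^ m) (q := L) (m₀ := coverMargin L m) L kk y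
  -- FILE 83
  have key := hasMaj_idef_comp_parametrix_of_commOp_h (g := unitTorusGeo L kk M) (fun b : Tor (fine (L ^ kk) M) × Fin (d + 1) => blockOf (L ^ kk) M b.1) (kingPrV L kk r M)
    (fun k => ((cubeBlocks M (coverCorner M (L ^ m) L (coverMargin L m) k) (L * L ^ m) : Finset (Tor M)) : Set (Tor M)))
    (D₃ := lapOp ((L ^ kk : ℕ) : ℝ) (bshiftEquiv M (L ^ kk)) 0) (D₃' := lapOp ((L ^ r * L ^ kk : ℕ) : ℝ) (bshiftEquiv M (L ^ r * L ^ kk)) 0)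
    (h := knitH d L m kk (L ^ kk) hL) (h' := knitH d L m kk (L ^ r * L ^ kk) hL) (G := knitG d L m kk (L ^ kk) hL a) (G' := knitG d L m kk (L ^ r * L ^ kk) hL a)
    hβ₃ hΘ (by positivity : (0 : ℝ) ≤ π * (d + 1) / (((L ^ kk : ℕ) : ℝ) * ((L ^ m : ℕ) : ℝ))) (by positivity : 0 ≤ m3 * ε) (by positivity : 0 ≤ Cr * ε)
    hh hfitH hN hE3 hKc' hIE3 hDK
  rw [← hblk] at key
  refine key.mono fun y y' => mul_le_mul_of_nonneg_right ?_ (Real.exp_nonneg _)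
  have ho : π * (d + 1) / (((L ^ kk : ℕ) : ℝ) * ((L ^ m : ℕ) : ℝ)) ≤ Ko * ε := by
    rw [div_eq_mul_inv]; exact mul_le_mul_of_nonneg_left hnwε (by positivity)
  have hcomp := entryThreeDefectConst_le (m₃ := m3) (Cr := Cr) (by positivity : 0 ≤ Nov) hβ₃ hΘ ho
  refine hcomp.trans ?_
  rw [hD_def, add_mul _ (1 : ℝ) ε, one_mul]
  exact le_add_of_nonneg_right hε0

end TwoGrid

end Summit.QuantumFields.YangMills.BalabanUVNodes.N15.Gluing

end
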